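import Summits.Ventures.CertifiedManyBodySolver.Downfold.EmeryShapeTrueCornerRule
import Summits.Ventures.CertifiedManyBodySolver.Downfold.EmeryFermiScalePointsLa214SOLX015TrueCorners
import HarnessLib

/-!
# THE ONE-BAND FERMI-SURFACE SHAPE `t′/t` OF THE WHOLE TYPED 3BE BOX `emeryBoxLa214v123 ∩ {Δ_pd ∈ [3.24, 4.0]} (solver-level Δ tag)` AT ITS TWO TRUE CORNERS (true-corner rule under certified margins, §B.87 (i);
# router/EMERY-SHAPE-CORNERS.tsv «true» rows)

Venture CertifiedManyBodySolver, cell `pub/hubbard-downfold` (stage S1; INFLATION-RULES-3to1-B §B.87 (i)), seat hubbard-downfold-mod-4 (technique B, g35 generator, g42 run (x ∈ {0.15, 0.07, 0.05, 0.03}, columns M16/M14/M53/M54, INFL-3to1-B §B.94–§B.97)); namespace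
`Summit.Ventures.CertifiedManyBodySolver.Downfold.Emery`. Everything PROVED (0 sorry). WHAT THIS IS NOT: a statement about La₂₋ₓSrₓCuO₄ box #18 — SOLVER-LEVEL Δ_pd members [3.24, 4.0] (§OF-RECORD v1.2 level tag) — the typed box is SCREENING-GRADE; `U = 0`
one-body kinematics of the σ model; object E = the EXACT `t–t′` shape of the σ Fermi surface at the row's own Fermi energy.

For EVERY one-body row of `[3.24, 4] × [1.29, 1.52] × [0.46, 0.66] × [0.12, 0.15]` eV the one-band `t′/t` lies between its values at the TRUE corners `(Δ₁, a₁, b₂, c₂)` and `(Δ₂, a₂, b₁, c₁)`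
(`EmeryShapeTrueCornerRule`; the t_pp / t_pp′ directions by the MARGIN LEVERS of `EmeryMarginLevers`, margins certified by `norm_num` with the constants `M` printed below), read
over their K = 384 brackets (`EmeryFermiScalePointsLa214SOLX015TrueCorners`).

| filling | **true-corner window (certified)** | margins (t_pp lower/upper; t_pp′ lower/upper) | two-ray (§B.86 (i)) | g19 sub-box device |
|---|---|---|---|---|
| x = 0.15 (ν = 17/40) | **[-0.2462, -0.1681]** | M_b 0.3156 / 4.0832; M_c 0.2684 / 0.0 | see EmeryBoxesLa214SOLShapeCorners | [-0.2955,-0.1653] (whole box, x = 0) |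

Sources: three-band model [HybertsenSchluterChristensen1989, Eq. (1)]; [AndersenEtAl1995, §6]; box rows as cited in the typed object's file.
-/

noncomputable section

namespace Summit.Ventures.CertifiedManyBodySolver.Downfold.Emery

open Real Set

/-- **x = 0.15 (ν = 17/40): for every row of the box the one-band Fermi-surface `t′/t` (object E) lies in `[-0.2462, -0.1681]` — its values at the two TRUE corners** (margin levers; margins by `norm_num`). [folklore] -/
theorem la214SOLX015Box_fsRatio_true_x015 {Δ a b c : ℝ} (hΔ : Δ ∈ Icc ((81 : ℝ) / 25) (4 : ℝ)) (ha : a ∈ Icc ((129 : ℝ) / 100) ((38 : ℝ) / 25)) (hb : b ∈ Icc ((23 : ℝ) / 50) ((33 : ℝ) / 50)) (hc : c ∈ Icc ((3 : ℝ) / 25) ((3 : ℝ) / 20)) :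
    fsRatio Δ a b c (fermiEnergyOf Δ a b c ((17 : ℝ) / 40)) ∈ Icc ((-1231 : ℝ) / 5000) ((-1681 : ℝ) / 10000) := by
  have hSL := (fermiEnergyOf_of_pointBracketCheck truePt_La214SOLX015SL_x015_br (by norm_num) (by norm_num) (by norm_num) (ν := (17/40 : ℝ)) (by push_cast; exact ⟨le_rfl, le_rfl⟩)).2
  have hTL := (fermiEnergyOf_of_pointBracketCheck truePt_La214SOLX015TL_x015_br (by norm_num) (by norm_num) (by norm_num) (ν := (17/40 : ℝ)) (by push_cast; exact ⟨le_rfl, le_rfl⟩)).2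
  have hSU := (fermiEnergyOf_of_pointBracketCheck truePt_La214SOLX015SU_x015_br (by norm_num) (by norm_num) (by norm_num) (ν := (17/40 : ℝ)) (by push_cast; exact ⟨le_rfl, le_rfl⟩)).2
  have hQU := (fermiEnergyOf_of_pointBracketCheck truePt_La214SOLX015QU_x015_br (by norm_num) (by norm_num) (by norm_num) (ν := (17/40 : ℝ)) (by push_cast; exact ⟨le_rfl, le_rfl⟩)).2
  have hTH := (fermiEnergyOf_of_pointBracketCheck truePt_La214SOLX015TH_x015_br (by norm_num) (by norm_num) (by norm_num) (ν := (17/40 : ℝ)) (by push_cast; exact ⟨le_rfl, le_rfl⟩)).2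
  have hAlo := (fermiEnergyOf_of_pointBracketCheck truePt_La214SOLX015AL_x015_br (by norm_num) (by norm_num) (by norm_num) (ν := (17/40 : ℝ)) (by push_cast; exact ⟨le_rfl, le_rfl⟩)).2
  have hTop := (fermiEnergyOf_of_pointBracketCheck truePt_La214SOLX015HH_x015_br (by norm_num) (by norm_num) (by norm_num) (ν := (17/40 : ℝ)) (by push_cast; exact ⟨le_rfl, le_rfl⟩)).2
  push_cast at hSL hTL hSU hQU hTH hAlo hTop
  norm_num at hSL hTL hSU hQU hTH hAlo hTop
  obtain ⟨hΔl, hΔu⟩ := hΔ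
  obtain ⟨hal, hau⟩ := ha
  constructor
  · have hlow := fsRatio_fermiEnergyOf_trueCorner_lower (Δ₁ := ((81 : ℝ) / 25)) (a₁ := ((129 : ℝ) / 100)) (b₁ := ((23 : ℝ) / 50)) (b₂ := ((33 : ℝ) / 50)) (c₁ := ((3 : ℝ) / 25)) (c₂ := ((3 : ℝ) / 20))
      (ν := ((17 : ℝ) / 40)) (pL := ((13019 : ℝ) / 10000)) (qL := ((6813 : ℝ) / 5000)) (Mb := ((789 : ℝ) / 2500)) (Mc := ((671 : ℝ) / 2500)) (by norm_num) hΔl (by norm_num) hal (by norm_num) hb (by norm_num) hc (by norm_num) (by norm_num) (by norm_num)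
      (by norm_num) hSL.1 hAlo.2 (by norm_num) (by norm_num [fsD, fsN]) (by norm_num) (by norm_num) (by norm_num [fsD, fsN]) (by norm_num) (by norm_num [dopingDisc]) (by norm_num [fsD, fsN])
    refine le_trans ?_ hlow
    have hw := (fsRatio_mem_Icc_on_window_of_dopingDisc_nonneg (Δ := ((81 : ℝ) / 25)) (a := ((129 : ℝ) / 100)) (b := ((33 : ℝ) / 50)) (c := ((3 : ℝ) / 20))
      (p := ((13331 : ℝ) / 10000)) (q := ((13431 : ℝ) / 10000)) (by norm_num) (by norm_num) (by norm_num) (by norm_num) (by norm_num) (by norm_num) (by norm_num) (by norm_num [dopingDisc]) hTL).1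
    refine le_trans ?_ hw
    norm_num [fsRatio, fsD, fsN]
  · have hup := fsRatio_fermiEnergyOf_trueCorner_upper (Δ₁ := ((81 : ℝ) / 25)) (Δ₂ := (4 : ℝ)) (a₁ := ((129 : ℝ) / 100)) (a₂ := ((38 : ℝ) / 25)) (b₁ := ((23 : ℝ) / 50)) (b₂ := ((33 : ℝ) / 50)) (c₁ := ((3 : ℝ) / 25)) (c₂ := ((3 : ℝ) / 20))
      (ν := ((17 : ℝ) / 40)) (pU := ((753 : ℝ) / 500)) (qU := ((15593 : ℝ) / 10000)) (qT := ((697 : ℝ) / 400)) (Mb := ((2552 : ℝ) / 625)) (Mc := (0 : ℝ)) (by norm_num) ⟨hΔl, hΔu⟩ (by norm_num) ⟨hal, hau⟩ (by norm_num) hb (by norm_num) hc (by norm_num) (by norm_num) (by norm_num)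
      hTop.2 (by norm_num) (by norm_num) hSU.1 hQU.2 (by norm_num) (by norm_num [fsD, fsN]) (by norm_num) (by norm_num) (by norm_num [fsD, fsN]) (by norm_num) (by norm_num) (by norm_num [fsD, fsN])
    refine le_trans hup ?_
    have hw := (fsRatio_mem_Icc_on_window_of_dopingDisc_nonpos (Δ := (4 : ℝ)) (a := ((38 : ℝ) / 25)) (b := ((23 : ℝ) / 50)) (c := ((3 : ℝ) / 25))
      (p := ((1527 : ℝ) / 1000)) (q := ((1537 : ℝ) / 1000)) (by norm_num) (by norm_num) (by norm_num) (by norm_num) (by norm_num) (by norm_num) (by norm_num) (by norm_num [dopingDisc]) hTH).2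
    refine le_trans hw ?_
    norm_num [fsRatio, fsD, fsN]

end Summit.Ventures.CertifiedManyBodySolver.Downfold.Emery
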